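import Mathlib
import Summits.ResolutionOfSingularities.ResolutionOfSingularities.Theorems.WildQuotientsWildQuotientResolutionTwoBlocksCentreStable
import Summits.ResolutionOfSingularities.ResolutionOfSingularities.Theorems.WildQuotientsWildQuotientResolutionJordanThreeCentre

/-!
# Rung V3, stage 0: the ideal sheaf of the first centre `V(x_a, x_b)` is stable under every action of `⟨J₃⟩`

(crux stmt-ResolutionOfSingularities-15640 `WildQuotients.WildQuotientResolution`, line `Sketch`,
sector `|G| = p`; rung V3 of `L/w45c/CHAIN.md` v4 §4 row stub-1; [OURS · L1 W4.5c] — NOT a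
statement of any manuscript; replaces the role of no printed item.)

`idealSheaf_centre_comap`: for the `J₃` datum `σ x_b = x_b + x_a`, `σ x_c = x_c + x_b` (identity on
the other coordinates, `a, b, c` distinct) and ANY action `ρ : ⟨σ⟩ →* Aut 𝔸ⁿ` with the affine-quotient
law `ρ g = Spec (g⁻¹)`, the ideal sheaf of the centre `(x_a, x_b)` satisfies
`(𝓘.comap (ρ g)) = 𝓘` for every `g` — VERBATIM the hypothesis `hρ` of `IsBlowup.liftAction` for the
first blow-up of the tower (`AffineQuotient.idealSheaf_comap_specAction` + `JordanThree.smul_centre_eq`;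
pattern `LinearSmallBlocks.idealSheaf_centre_comap`).
-/

-- single-problem summit: the doubled namespace component `ResolutionOfSingularities` is forced
set_option linter.dupNamespace false

noncomputable section

open CategoryTheory AlgebraicGeometry MvPolynomial
open scoped Pointwise
open Literature.AlgebraicGeometry.Resolution

namespace Summit.ResolutionOfSingularities.ResolutionOfSingularities.Theorems.WildQuotientResolution.JordanThree

/-- **The ideal sheaf of the centre `(x_a, x_b)` on `𝔸ⁿ` is stable under the action of `⟨σ⟩`**
(`ρ g = Spec (g⁻¹)`) for the `J₃` datum — the hypothesis `hρ` of `IsBlowup.liftAction` for step 1 of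
the V3 tower. [folklore] -/
theorem idealSheaf_centre_comap (k : Type) [Field k] (n : ℕ)
    (σ : MvPolynomial (Fin n) k ≃ₐ[k] MvPolynomial (Fin n) k) (a b c : Fin n)
    (hab : a ≠ b) (hac : a ≠ c) (hb : σ (X b) = X b + X a)
    (hσ : ∀ i, i ≠ b → i ≠ c → σ (X i) = X i)
    (ρ : ↥(Subgroup.zpowers σ) →* Aut (Spec (CommRingCat.of (MvPolynomial (Fin n) k))))
    (hρ : ∀ g : ↥(Subgroup.zpowers σ), (ρ g).hom = Spec.map (CommRingCat.ofHom
      ((MulSemiringAction.toRingEquiv (↥(Subgroup.zpowers σ)) (MvPolynomial (Fin n) k) g⁻¹ :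
        MvPolynomial (Fin n) k ≃+* MvPolynomial (Fin n) k) :
          MvPolynomial (Fin n) k →+* MvPolynomial (Fin n) k)))
    (g : ↥(Subgroup.zpowers σ)) :
    (affineBlowup.idealSheaf (Ideal.span ({X a, X b} : Set (MvPolynomial (Fin n) k)))).comap
        (ρ g).hom =
      affineBlowup.idealSheaf (Ideal.span ({X a, X b} : Set (MvPolynomial (Fin n) k))) :=
  AffineQuotient.idealSheaf_comap_specAction ρ hρ _ (smul_centre_eq k n σ a b c hab hac hb hσ) g

end Summit.ResolutionOfSingularities.ResolutionOfSingularities.Theorems.WildQuotientResolution.JordanThree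

end
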